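import Summits.Ventures.LatticeQCDFlow.Scaling.PlaquetteCorrelatorLogConvex

/-!
HONEST FRAMING: exact (Metropolis-corrected) sampling algorithms for lattice gauge theory; figures
of merit are autocorrelation/cost numbers at stated couplings and volumes; no continuum-physics
claim.

# PlaquetteCorrelatorFloor — LOG-CONVEXITY ON EVERY TORUS AND THE GEOMETRIC LOWER BOUND
# `g(n) ≥ g(0)·(g(1)/g(0))ⁿ ≥ δ·(δ/N²)ⁿ` FOR THE TEMPORAL PLAQUETTE CORRELATOR (lean-1 GEN-11, ours;
# part 3 of 4 of the strong-coupling clustering floor (U″))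

Venture-side (OURS). Cell `lqcd-flow` (pub-lqcd), unit `pub-lqcd-lean-1-g11`, 2026-08-23.

* §1 `geom_lower_of_logConvex` — a real sequence with `g(0), g(1) > 0` and
  `g(n)² ≤ g(n−1) g(n+1)` for `1 ≤ n ≤ M − 1` has non-decreasing ratios, hence
  `g(n) ≥ g(0)·(g(1)/g(0))ⁿ > 0` for all `n ≤ M` [folklore].
* §2 ON EVERY TORUS `L ≥ 3`, `β ≥ 0`, spatial orientation `i, j ≠ 0`, time-zero base site:
  **`g(n)² ≤ g(n−1)·g(n+1)` for all `1 ≤ n ≤ L − 2`** (`sq_tCorr_le`; parity bookkeeping over the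
  three Schwarz inequalities of `PlaquetteCorrelatorLogConvex`, using `g(m) = g(L − m)` on odd tori),
  **`g(1) ≤ g(0) ≤ N²`** (`tCorr_one_le_zero`, `tCorr_zero_le`), and the FLOOR
  (`tCorr_ge_geometric`): if `δ ≤ g(1)` with `δ > 0` then `δ·(δ/N²)ⁿ ≤ g(n)` for all `n ≤ L − 1`.

NOT CLAIMED: anything at `β < 0` or for temporal plaquettes; sharpness of the rate.  Literature grade
(cell rule): known mechanism (transfer-matrix / reflection-positivity monotonicity of correlation
ratios); new typing, no new theorem of physics.
-/

noncomputable section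

namespace Summit.Ventures.LatticeQCDFlow.Theory2.Clustering

open MeasureTheory Literature.MathematicalPhysics.QuantumFieldTheory

/-! ## §1 Log-convex positive sequences are bounded below geometrically -/

section Sequence

/-- Ratios of a log-convex positive sequence are non-decreasing: positivity propagates and
`g(n−1)·g(1) ≤ g(n)·g(0)` for `1 ≤ n ≤ M`. [folklore] -/
theorem ratio_mono_of_logConvex {g : ℕ → ℝ} {M : ℕ} (h0 : 0 < g 0) (h1 : 0 < g 1)
    (hconv : ∀ n, 1 ≤ n → n + 1 ≤ M → g n ^ 2 ≤ g (n - 1) * g (n + 1)) :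
    ∀ n, 1 ≤ n → n ≤ M → 0 < g (n - 1) ∧ 0 < g n ∧ g (n - 1) * g 1 ≤ g n * g 0 := by
  intro n hn hnM
  induction n, hn using Nat.le_induction with
  | base => exact ⟨h0, h1, le_of_eq (by ring)⟩
  | succ n hn ih =>
    obtain ⟨hpm, hpn, hrat⟩ := ih (by omega)
    have hc := hconv n hn hnM
    have hsq : 0 < g n ^ 2 := by positivity
    have hpos : 0 < g (n + 1) := by
      rcases le_or_gt (g (n + 1)) 0 with hle | hgt
      · have : g (n - 1) * g (n + 1) ≤ 0 := mul_nonpos_of_nonneg_of_nonpos hpm.le hle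
        linarith
      · exact hgt
    refine ⟨by simpa using hpn, hpos, ?_⟩
    show g (n + 1 - 1) * g 1 ≤ g (n + 1) * g 0
    rw [Nat.add_sub_cancel]
    have e1 : g (n - 1) * (g n * g 1) ≤ g (n - 1) * (g (n + 1) * g 0) :=
      calc g (n - 1) * (g n * g 1) = (g (n - 1) * g 1) * g n := by ring
        _ ≤ (g n * g 0) * g n := mul_le_mul_of_nonneg_right hrat hpn.le
        _ = g 0 * g n ^ 2 := by ring
        _ ≤ g 0 * (g (n - 1) * g (n + 1)) := mul_le_mul_of_nonneg_left hc h0.le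
        _ = g (n - 1) * (g (n + 1) * g 0) := by ring
    exact le_of_mul_le_mul_left e1 hpm

/-- **Geometric lower bound for log-convex positive sequences**:
`g(0)·(g(1)/g(0))ⁿ ≤ g(n)` (and `g(n) > 0`) for all `n ≤ M`. [folklore] -/
theorem geom_lower_of_logConvex {g : ℕ → ℝ} {M : ℕ} (h0 : 0 < g 0) (h1 : 0 < g 1)
    (hconv : ∀ n, 1 ≤ n → n + 1 ≤ M → g n ^ 2 ≤ g (n - 1) * g (n + 1)) :
    ∀ n, n ≤ M → 0 < g n ∧ g 0 * (g 1 / g 0) ^ n ≤ g n := by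
  intro n hnM
  induction n with
  | zero => exact ⟨h0, by simp⟩
  | succ n ih =>
    obtain ⟨-, ihle⟩ := ih (by omega)
    obtain ⟨_, hpos, hrat⟩ := ratio_mono_of_logConvex h0 h1 hconv (n + 1) (by omega) hnM
    rw [Nat.add_sub_cancel] at hrat
    refine ⟨hpos, ?_⟩
    have hr : 0 ≤ g 1 / g 0 := div_nonneg h1.le h0.le
    have hstep : g n * (g 1 / g 0) ≤ g (n + 1) := by
      rw [mul_div_assoc', div_le_iff₀ h0]
      exact hrat
    calc g 0 * (g 1 / g 0) ^ (n + 1) = (g 0 * (g 1 / g 0) ^ n) * (g 1 / g 0) := by ring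
      _ ≤ g n * (g 1 / g 0) := mul_le_mul_of_nonneg_right ihle hr
      _ ≤ g (n + 1) := hstep

end Sequence

/-! ## §2 The temporal plaquette correlator on every torus -/

section Torus

variable {d L N : ℕ} [NeZero d] [NeZero L] {G : Type*} [Group G] [TopologicalSpace G]
  [IsTopologicalGroup G] [CompactSpace G] [MeasurableSpace G] [BorelSpace G]
  [SecondCountableTopology G] (ρ : G →* Matrix (Fin N) (Fin N) ℂ)

omit [SecondCountableTopology G] in
/-- Periodicity in the form used on odd tori: `g(L − a) = g(a)` for `a ≤ L` (`(L − a) ≡ −a`). -/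
theorem tCorr_sub_eq (β : ℝ) (x : Site d L) (i j : Fin d) {a : ℕ} (ha : a ≤ L) :
    tCorr ρ β x i j (((L - a : ℕ)) : ZMod L) = tCorr ρ β x i j ((a : ℕ) : ZMod L) := by
  rw [Nat.cast_sub ha, ZMod.natCast_self, zero_sub, corr_neg]

/-- **LOG-CONVEXITY ON EVERY TORUS.**  For `L ≥ 3`, `β ≥ 0`, a time-zero base site, a spatial
orientation `i, j ≠ 0` and every `1 ≤ n ≤ L − 2`: `g(n)² ≤ g(n−1)·g(n+1)`. -/
theorem sq_tCorr_le (hL3 : 3 ≤ L) (hρ : Continuous ρ) {β : ℝ} (hβ : 0 ≤ β) {x : Site d L}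
    (hx : x 0 = 0) {i j : Fin d} (hi : i ≠ 0) (hj : j ≠ 0) {n : ℕ} (hn1 : 1 ≤ n) (hn : n + 2 ≤ L) :
    (tCorr ρ β x i j ((n : ℕ) : ZMod L)) ^ 2
      ≤ tCorr ρ β x i j (((n - 1 : ℕ)) : ZMod L) * tCorr ρ β x i j (((n + 1 : ℕ)) : ZMod L) := by
  rcases Nat.even_or_odd L with hLe | hLo
  · rcases Nat.even_or_odd n with ⟨k, hk⟩ | ⟨k, hk⟩
    · -- even `n = 2k`, link reflection with `t = k`, `s = k + 1`
      have h := sq_corr_le_link ρ hLe hρ hβ hx hi hj (s := k + 1) (t := k) (by omega)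
        (by omega) (by omega) (by omega)
      have e1 : k + 1 + k - 1 = n := by omega
      have e2 : 2 * k - 1 = n - 1 := by omega
      have e3 : 2 * (k + 1) - 1 = n + 1 := by omega
      rw [e1, e2, e3] at h
      exact h
    · -- odd `n = 2k + 1`, site reflection with `t = k`, `s = k + 1`
      have h := sq_corr_le_site ρ hLe hρ β hx hi hj (s := k + 1) (t := k) (by omega) (by omega)
      have e1 : k + 1 + k = n := by omega
      have e2 : 2 * k = n - 1 := by omega
      have e3 : 2 * (k + 1) = n + 1 := by omega
      rw [e1, e2, e3] at h
      exact h
  · rcases Nat.even_or_odd n with ⟨k, hk⟩ | ⟨k, hk⟩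
    · -- odd torus, even `n = 2k`: the mixed reflection with `t = k`, `s = k + 1`
      have h := sq_corr_le_odd ρ hLo hL3 hρ hβ hx hi hj (s := k + 1) (t := k) (by omega)
        (by omega) (by omega) (by omega)
      have e1 : k + 1 + k - 1 = n := by omega
      have e2 : 2 * k - 1 = n - 1 := by omega
      have e3 : 2 * (k + 1) - 1 = n + 1 := by omega
      rw [e1, e2, e3] at h
      exact h
    · -- odd torus `L = 2m + 1`, odd `n = 2k + 1`: use `n' = L − n = 2(m − k)`, even
      obtain ⟨m, hm⟩ := hLo
      have h := sq_corr_le_odd ρ ⟨m, hm⟩ hL3 hρ hβ hx hi hj (s := m - k + 1) (t := m - k)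
        (by omega) (by omega) (by omega) (by omega)
      have e1 : m - k + 1 + (m - k) - 1 = L - n := by omega
      have e2 : 2 * (m - k) - 1 = L - (n + 1) := by omega
      have e3 : 2 * (m - k + 1) - 1 = L - (n - 1) := by omega
      rw [e1, e2, e3, tCorr_sub_eq ρ β x i j (by omega), tCorr_sub_eq ρ β x i j (by omega),
        tCorr_sub_eq ρ β x i j (by omega), mul_comm] at h
      exact h

/-- `g(0) ≤ N²` (`g(0) = E[P²] − E[P]²`, `|P| ≤ N`). -/
theorem tCorr_zero_le (hρ : Continuous ρ) (β : ℝ) (x : Site d L) (i j : Fin d) :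
    tCorr ρ β x i j 0 ≤ (N : ℝ) ^ 2 := by
  haveI := isProbabilityMeasure_wilsonMeasure (d := d) (L := L) ρ hρ β
  have hc : Continuous (tObs ρ x i j 0) := continuous_tObs ρ hρ x i j 0
  have hb : ∀ U : GaugeConfig d L G, tObs ρ x i j 0 U * tObs ρ x i j 0 U ≤ (N : ℝ) ^ 2 := by
    intro U
    have h0 : |tObs ρ x i j 0 U| ≤ N := by
      unfold tObs
      exact abs_plaqObs_le ρ hρ U _ i j
    have h := abs_le.1 h0
    nlinarith [h.1, h.2]
  have hE : wilsonExpectation ρ β (fun U : GaugeConfig d L G => tObs ρ x i j 0 U * tObs ρ x i j 0 U)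
      ≤ (N : ℝ) ^ 2 := by
    unfold wilsonExpectation
    have h := integral_mono (μ := wilsonMeasure ρ β) ((hc.mul hc).integrable_of_hasCompactSupport
      (HasCompactSupport.of_compactSpace _)) (integrable_const ((N : ℝ) ^ 2)) hb
    rwa [integral_const, smul_eq_mul, probReal_univ, one_mul] at h
  unfold tCorr
  nlinarith [sq_nonneg (wilsonExpectation ρ β (tObs ρ x i j 0))]

/-- `g(1) ≤ g(0)`: `0 ≤ E[((P_0 − c) − (P_1 − c))²] = 2 g(0) − 2 g(1)`. -/
theorem tCorr_one_le_zero (hρ : Continuous ρ) (β : ℝ) (x : Site d L) (i j : Fin d) :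
    tCorr ρ β x i j 1 ≤ tCorr ρ β x i j 0 := by
  haveI := isProbabilityMeasure_wilsonMeasure (d := d) (L := L) ρ hρ β
  set c := wilsonExpectation ρ β (tObs ρ x i j 0) with hc
  have hA : ∀ m : ZMod L, Continuous fun U : GaugeConfig d L G => tObs ρ x i j m U - c := fun m =>
    (continuous_tObs ρ hρ x i j m).sub continuous_const
  have hint : ∀ m m' : ZMod L, Integrable (fun U : GaugeConfig d L G =>
      (tObs ρ x i j m U - c) * (tObs ρ x i j m' U - c)) (wilsonMeasure ρ β) := fun m m' =>
    ((hA m).mul (hA m')).integrable_of_hasCompactSupport (HasCompactSupport.of_compactSpace _)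
  have h00 := integral_centred_Pobs ρ hρ β x i j 0 0
  have h01 := integral_centred_Pobs ρ hρ β x i j 0 1
  have h11 := integral_centred_Pobs ρ hρ β x i j 1 1
  rw [← hc] at h00 h01 h11
  simp only [sub_zero, sub_self] at h00 h01 h11
  have hnn : 0 ≤ ∫ U, ((tObs ρ x i j 0 U - c) - (tObs ρ x i j 1 U - c)) ^ 2 ∂(wilsonMeasure ρ β) :=
    integral_nonneg fun U => sq_nonneg _
  have hexp : ∫ U, ((tObs ρ x i j 0 U - c) - (tObs ρ x i j 1 U - c)) ^ 2 ∂(wilsonMeasure ρ β)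
      = tCorr ρ β x i j 0 - 2 * tCorr ρ β x i j 1 + tCorr ρ β x i j 0 := by
    have e : (fun U : GaugeConfig d L G => ((tObs ρ x i j 0 U - c) - (tObs ρ x i j 1 U - c)) ^ 2)
        = fun U => ((tObs ρ x i j 0 U - c) * (tObs ρ x i j 0 U - c)
            - 2 * ((tObs ρ x i j 0 U - c) * (tObs ρ x i j 1 U - c)))
            + (tObs ρ x i j 1 U - c) * (tObs ρ x i j 1 U - c) := by
      funext U; ring
    have i2 : Integrable (fun U : GaugeConfig d L G =>
        2 * ((tObs ρ x i j 0 U - c) * (tObs ρ x i j 1 U - c))) (wilsonMeasure ρ β) :=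
      (hint 0 1).const_mul 2
    have i1 : Integrable (fun U : GaugeConfig d L G =>
        (tObs ρ x i j 0 U - c) * (tObs ρ x i j 0 U - c)
          - 2 * ((tObs ρ x i j 0 U - c) * (tObs ρ x i j 1 U - c))) (wilsonMeasure ρ β) :=
      (hint 0 0).sub i2
    rw [e, integral_add i1 (hint 1 1), integral_sub (hint 0 0) i2, integral_const_mul, h00, h01, h11]
  linarith

/-- **THE GEOMETRIC FLOOR ON ONE TORUS.**  For `L ≥ 3`, `β ≥ 0`, a time-zero base site, a spatial
orientation `i, j ≠ 0`: if `0 < δ ≤ g(1)` then `δ·(δ/N²)ⁿ ≤ g(n)` for all `n ≤ L − 1`. -/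
theorem tCorr_ge_geometric (hL3 : 3 ≤ L) (hρ : Continuous ρ) {β : ℝ} (hβ : 0 ≤ β) {x : Site d L}
    (hx : x 0 = 0) {i j : Fin d} (hi : i ≠ 0) (hj : j ≠ 0) {δ : ℝ} (hδ : 0 < δ)
    (hδ1 : δ ≤ tCorr ρ β x i j 1) {n : ℕ} (hn : n + 1 ≤ L) :
    δ * (δ / (N : ℝ) ^ 2) ^ n ≤ tCorr ρ β x i j ((n : ℕ) : ZMod L) := by
  set g : ℕ → ℝ := fun k => tCorr ρ β x i j ((k : ℕ) : ZMod L) with hg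
  have hg0 : g 0 = tCorr ρ β x i j 0 := by simp [hg]
  have hg1 : g 1 = tCorr ρ β x i j 1 := by simp [hg]
  have h10 := tCorr_one_le_zero ρ hρ β x i j
  have hN2 := tCorr_zero_le ρ hρ β x i j
  have h1 : 0 < g 1 := by rw [hg1]; linarith
  have h0 : 0 < g 0 := by rw [hg0]; linarith
  have hconv : ∀ k, 1 ≤ k → k + 1 ≤ L - 1 → g k ^ 2 ≤ g (k - 1) * g (k + 1) := fun k hk1 hk =>
    sq_tCorr_le ρ hL3 hρ hβ hx hi hj hk1 (by omega)
  obtain ⟨-, hge⟩ := geom_lower_of_logConvex h0 h1 hconv n (by omega)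
  refine le_trans ?_ hge
  -- `δ (δ/N²)ⁿ ≤ g 0 (g 1 / g 0)ⁿ`
  have hNpos : 0 < (N : ℝ) ^ 2 := by rw [hg0] at h0; linarith
  have hr : δ / (N : ℝ) ^ 2 ≤ g 1 / g 0 := by
    rw [div_le_div_iff₀ hNpos h0]
    calc δ * g 0 ≤ δ * (N : ℝ) ^ 2 := mul_le_mul_of_nonneg_left (by rw [hg0]; exact hN2) hδ.le
      _ ≤ g 1 * (N : ℝ) ^ 2 := mul_le_mul_of_nonneg_right (by rw [hg1]; exact hδ1) hNpos.le
  have hq : 0 ≤ δ / (N : ℝ) ^ 2 := div_nonneg hδ.le hNpos.le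
  calc δ * (δ / (N : ℝ) ^ 2) ^ n ≤ g 0 * (δ / (N : ℝ) ^ 2) ^ n :=
        mul_le_mul_of_nonneg_right (by rw [hg0]; linarith) (pow_nonneg hq n)
    _ ≤ g 0 * (g 1 / g 0) ^ n := mul_le_mul_of_nonneg_left (pow_le_pow_left₀ hq hr n) h0.le

end Torus

end Summit.Ventures.LatticeQCDFlow.Theory2.Clustering
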